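import Summits.AtomisticToContinuum.Crystallization.Theses.PalmUnimodularRigidity
import Summits.AtomisticToContinuum.Crystallization.Theorems.MinimiserShells.Negative.LoadBearing
import Summits.AtomisticToContinuum.Crystallization.Theorems.MinimiserShells.Negative.Rootedness
import Literature.Probability.Process.PointStationaryLaw
import Literature.MathematicalPhysics.StatisticalMechanics.RootEnergy
import Literature.MathematicalPhysics.StatisticalMechanics.MuGSC

/-!
# The random grid: cells, the phase cube, periodicity, depth, and phase volumes

Helper file for stub `stub_equilibriumInLaw` (S1) of line `equilibrium-in-law-surgery`, crux
`MinimiserShells` (stmt-AtomisticToContinuum-9225): the deterministic half of blueprint lemmas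
9–10 (the grid `u + Lℤ³` with one phase `u ∈ [0, L)³`).

* `cube L = [0, L)³` (the phase cube), `cellIdx L u z = (⌊(z_i − u_i)/L⌋)_i`, `cell L u` = the
  cell of the grid `u + Lℤ³` containing the root `0`;
* shift identities: `cellIdx L (u + y) (z + y) = cellIdx L u z`, `-y ∈ cell L u ↔ y ∈ cell L (u + y)`,
  `(· − y) ⁻¹' cell L u = cell L (u + y)` for `y ∈ cell L (u + y)`, `z ∈ cell L (u − y) ↔ z + y ∈ cell L u`
  for `y ∈ cell L u` (re-rooting at an atom of the cell shifts the phase);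
* cells are bounded (`cell L u ⊆ B̄(0, 2L)`), hence meet separated sets in finite sets;
* `depth L u` — the distance from the root to the boundary of its cell (`min_i min(L{u_i/L}, L − L{u_i/L})`),
  `closedBall_subset_cell : ρ < depth L u → B̄(0, ρ) ⊆ cell L u`;
* (periodicity, the fundamental-domain shift lemma and the phase volumes are in the companion
  file `…EquilibriumInLawLattice`).
-/

noncomputable section

open MeasureTheory
open scoped ENNReal BigOperators Pointwise

namespace Summit.AtomisticToContinuum.Crystallization.Theorems.PalmUnimodularRigidityMinimiserShells.EquilibriumInLaw.Phase

open Literature.Probability.Process (IsPointStationaryLaw IsRootedHardCore count_restrict_singleton_ne_zero_iff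
  map_sub_count_restrict)
open Literature.MathematicalPhysics.StatisticalMechanics (lennardJones IsMuGSC UniformlyDiscrete)
open Summit.AtomisticToContinuum.Crystallization.Theses.PalmUnimodularRigidity (MinimiserShells UnimodularEnergyLowerBound)
open Summit.AtomisticToContinuum.Crystallization.Theorems.MinimiserShells.Negative.LoadBearing
  (eStar meanRootEnergy GoodShell minimiserShells_iff)
open Summit.AtomisticToContinuum.Crystallization.Theorems.MinimiserShells.Negative.Rootedness (E3)

/-! ## Cells and the phase cube -/

/-- The phase cube `[0, L)³`. -/
def cube (L : ℝ) : Set E3 := {u | ∀ i, u i ∈ Set.Ico 0 L}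

/-- The index of the cell of the grid `u + Lℤ³` containing `z`. -/
def cellIdx (L : ℝ) (u z : E3) (i : Fin 3) : ℤ := ⌊(z i - u i) / L⌋

/-- The cell of the grid `u + Lℤ³` containing the root `0`. -/
def cell (L : ℝ) (u : E3) : Set E3 := {z | ∀ i, cellIdx L u z i = cellIdx L u 0 i}

/-- The coordinate maps are continuous. -/
theorem continuous_coord (i : Fin 3) : Continuous fun u : E3 => u i := PiLp.continuous_apply 2 _ i

/-- The cell index is jointly measurable in (phase, point). -/
theorem measurable_cellIdx (L : ℝ) (i : Fin 3) : Measurable fun p : E3 × E3 => cellIdx L p.1 p.2 i :=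
  Int.measurable_floor.comp ((((continuous_coord i).comp continuous_snd).sub
    ((continuous_coord i).comp continuous_fst)).div_const L).measurable

/-- The relation "`z` lies in the root's cell for phase `u`" is jointly measurable. -/
theorem measurableSet_cellRel (L : ℝ) : MeasurableSet {p : E3 × E3 | p.2 ∈ cell L p.1} := by
  have : {p : E3 × E3 | p.2 ∈ cell L p.1} = ⋂ i, {p : E3 × E3 | cellIdx L p.1 p.2 i = cellIdx L p.1 0 i} := by
    ext p
    simp only [cell, Set.mem_setOf_eq, Set.mem_iInter]
  rw [this]
  exact MeasurableSet.iInter fun i => measurableSet_eq_fun (measurable_cellIdx L i)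
    ((measurable_cellIdx L i).comp (measurable_fst.prodMk measurable_const))

/-- Cells are measurable. -/
theorem measurableSet_cell (L : ℝ) (u : E3) : MeasurableSet (cell L u) :=
  (measurableSet_cellRel L).preimage (measurable_const.prodMk measurable_id : Measurable fun z : E3 => (u, z))

/-- The phase cube is measurable. -/
theorem measurableSet_cube (L : ℝ) : MeasurableSet (cube L) := by
  have : cube L = ⋂ i, {u : E3 | u i ∈ Set.Ico 0 L} := by
    ext u; simp [cube]
  rw [this]
  exact MeasurableSet.iInter fun i => measurableSet_Ico.preimage (continuous_coord i).measurable

/-- The root lies in its cell. -/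
theorem zero_mem_cell (L : ℝ) (u : E3) : (0 : E3) ∈ cell L u := fun _ => rfl

/-- Points of a cell have coordinates of absolute value `< L`. -/
theorem abs_coord_lt_of_mem_cell {L : ℝ} (hL : 0 < L) {u z : E3} (hz : z ∈ cell L u) (i : Fin 3) :
    |z i| < L := by
  have h := hz i
  simp only [cellIdx] at h
  have h0 : ((0 : E3) i : ℝ) = 0 := rfl
  rw [h0] at h
  have h1 := Int.floor_le ((z i - u i) / L)
  have h2 := Int.lt_floor_add_one ((z i - u i) / L)
  have h3 := Int.floor_le ((0 - u i) / L)
  have h4 := Int.lt_floor_add_one ((0 - u i) / L)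
  rw [h] at h1 h2
  rw [abs_lt]
  constructor
  · have : (0 - u i) / L - 1 < (z i - u i) / L := by linarith
    rw [div_sub_one hL.ne', div_lt_div_iff_of_pos_right hL] at this
    linarith
  · have : (z i - u i) / L < (0 - u i) / L + 1 := by linarith
    rw [div_add_one hL.ne', div_lt_div_iff_of_pos_right hL] at this
    linarith

/-- Cells are bounded: `cell L u ⊆ B̄(0, 2L)`. -/
theorem cell_subset_closedBall {L : ℝ} (hL : 0 < L) (u : E3) : cell L u ⊆ Metric.closedBall 0 (2 * L) := by
  intro z hz
  rw [Metric.mem_closedBall, dist_zero_right, EuclideanSpace.norm_eq]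
  have hsum : ∑ i, ‖z i‖ ^ 2 ≤ ∑ _i : Fin 3, L ^ 2 := by
    refine Finset.sum_le_sum fun i _ => ?_
    have := abs_coord_lt_of_mem_cell hL hz i
    rw [Real.norm_eq_abs]
    exact pow_le_pow_left₀ (abs_nonneg _) this.le 2
  rw [Finset.sum_const, Finset.card_univ, Fintype.card_fin] at hsum
  calc Real.sqrt (∑ i, ‖z i‖ ^ 2) ≤ Real.sqrt (3 • L ^ 2) := Real.sqrt_le_sqrt hsum
    _ ≤ Real.sqrt ((2 * L) ^ 2) := Real.sqrt_le_sqrt (by rw [nsmul_eq_mul]; push_cast; nlinarith)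
    _ = 2 * L := Real.sqrt_sq (by linarith)

/-- A separated set meets every cell in a finite set. -/
theorem finite_inter_cell {L δ : ℝ} (hL : 0 < L) (hδ : 0 < δ) {S : Set E3}
    (hsep : ∀ x ∈ S, ∀ y ∈ S, x ≠ y → δ ≤ dist x y) (u : E3) : (S ∩ cell L u).Finite :=
  (UniformlyDiscrete.finite_inter_closedBall ⟨δ, hδ, hsep⟩ 0 (2 * L)).subset
    (Set.inter_subset_inter_right S (cell_subset_closedBall hL u))

/-! ## Shift identities -/

/-- Shifting phase and point together does not change the cell index. -/
theorem cellIdx_add (L : ℝ) (u z y : E3) : cellIdx L (u + y) (z + y) = cellIdx L u z := by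
  funext i
  simp only [cellIdx]
  congr 2
  change (z i + y i) - (u i + y i) = z i - u i
  ring

/-- `-y` lies in the root's cell for phase `u` iff `y` lies in the root's cell for phase `u + y`. -/
theorem neg_mem_cell_iff (L : ℝ) (u y : E3) : -y ∈ cell L u ↔ y ∈ cell L (u + y) := by
  have h1 : cellIdx L u (-y) = cellIdx L (u + y) 0 := by
    rw [← cellIdx_add L u (-y) y, neg_add_cancel]
  have h2 : cellIdx L u 0 = cellIdx L (u + y) y := by
    rw [← cellIdx_add L u 0 y, zero_add]
  simp only [cell, Set.mem_setOf_eq, h1, h2]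
  exact ⟨fun h i => (h i).symm, fun h i => (h i).symm⟩

/-- Re-rooting at an atom `y` of the root's cell: the pulled-back cell is the cell for the shifted
phase, `(· − y) ⁻¹' cell L u = cell L (u + y)` when `y ∈ cell L (u + y)`. -/
theorem preimage_sub_cell (L : ℝ) {u y : E3} (hy : y ∈ cell L (u + y)) :
    (fun z => z - y) ⁻¹' cell L u = cell L (u + y) := by
  ext z
  have h1 : cellIdx L u (z - y) = cellIdx L (u + y) z := by
    rw [← cellIdx_add L u (z - y) y, sub_add_cancel]
  have h2 : cellIdx L u 0 = cellIdx L (u + y) y := by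
    rw [← cellIdx_add L u 0 y, zero_add]
  simp only [Set.mem_preimage, cell, Set.mem_setOf_eq, h1, h2]
  exact ⟨fun h i => (h i).trans (hy i), fun h i => (h i).trans (hy i).symm⟩

/-- The cell seen from an atom `y` of it: `z ∈ cell L (u − y) ↔ z + y ∈ cell L u` when `y ∈ cell L u`. -/
theorem mem_cell_sub_iff (L : ℝ) {u y : E3} (hy : y ∈ cell L u) (z : E3) :
    z ∈ cell L (u - y) ↔ z + y ∈ cell L u := by
  have h1 : cellIdx L (u - y) z = cellIdx L u (z + y) := by
    rw [← cellIdx_add L (u - y) z y, sub_add_cancel]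
  have h2 : cellIdx L (u - y) 0 = cellIdx L u y := by
    rw [← cellIdx_add L (u - y) 0 y, zero_add, sub_add_cancel]
  simp only [cell, Set.mem_setOf_eq, h1, h2]
  exact ⟨fun h i => (h i).trans (hy i), fun h i => (h i).trans (hy i).symm⟩

/-! ## Depth -/

/-- The distance from the root to the boundary of its cell in coordinate `i`. -/
def coordDepth (L : ℝ) (u : E3) (i : Fin 3) : ℝ :=
  min (L * Int.fract (u i / L)) (L - L * Int.fract (u i / L))

/-- The depth of the root in its cell: `min_i coordDepth i`. -/
def depth (L : ℝ) (u : E3) : ℝ := min (min (coordDepth L u 0) (coordDepth L u 1)) (coordDepth L u 2)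

/-- The coordinate depths are measurable. -/
theorem measurable_coordDepth (L : ℝ) (i : Fin 3) : Measurable fun u : E3 => coordDepth L u i := by
  have h : Measurable fun u : E3 => L * Int.fract (u i / L) :=
    (measurable_fract.comp ((continuous_coord i).measurable.div_const L)).const_mul L
  exact h.min (measurable_const.sub h)

/-- The depth is measurable. -/
theorem measurable_depth (L : ℝ) : Measurable (depth L) :=
  ((measurable_coordDepth L 0).min (measurable_coordDepth L 1)).min (measurable_coordDepth L 2)

/-- The depth is at most each coordinate depth. -/
theorem depth_le_coordDepth (L : ℝ) (u : E3) (i : Fin 3) : depth L u ≤ coordDepth L u i := by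
  fin_cases i
  · exact (min_le_left _ _).trans (min_le_left _ _)
  · exact (min_le_left _ _).trans (min_le_right _ _)
  · exact min_le_right _ _

/-- The depth is one of the coordinate depths. -/
theorem exists_depth_eq_coordDepth (L : ℝ) (u : E3) : ∃ i, depth L u = coordDepth L u i := by
  unfold depth
  rcases min_choice (min (coordDepth L u 0) (coordDepth L u 1)) (coordDepth L u 2) with h | h
  · rw [h]
    rcases min_choice (coordDepth L u 0) (coordDepth L u 1) with h' | h'
    · exact ⟨0, h'⟩
    · exact ⟨1, h'⟩
  · exact ⟨2, h⟩

/-- The depth is non-negative. -/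
theorem depth_nonneg {L : ℝ} (hL : 0 ≤ L) (u : E3) : 0 ≤ depth L u := by
  have : ∀ i, 0 ≤ coordDepth L u i := fun i => by
    unfold coordDepth
    have h0 := Int.fract_nonneg (u i / L)
    have h1 := (Int.fract_lt_one (u i / L)).le
    exact le_min (by positivity) (by nlinarith)
  exact le_min (le_min (this 0) (this 1)) (this 2)

/-- **Deep roots have a ball inside their cell**: `ρ < depth L u → B̄(0, ρ) ⊆ cell L u`. -/
theorem closedBall_subset_cell {L : ℝ} (hL : 0 < L) {ρ : ℝ} {u : E3} (h : ρ < depth L u) :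
    Metric.closedBall (0 : E3) ρ ⊆ cell L u := by
  intro z hz i
  rw [Metric.mem_closedBall, dist_zero_right] at hz
  have hzi : |z i| ≤ ρ := (Real.norm_eq_abs _ ▸ PiLp.norm_apply_le z i).trans hz
  have hρ : ρ < coordDepth L u i := h.trans_le (depth_le_coordDepth L u i)
  set f : ℝ := Int.fract (u i / L) with hf
  set n : ℤ := ⌊u i / L⌋ with hn
  have huf : u i / L = n + f := (Int.floor_add_fract (u i / L)).symm
  have hf0 : 0 ≤ f := Int.fract_nonneg _
  have hf1 : f < 1 := Int.fract_lt_one _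
  -- `f = 0` would force `ρ < 0`, contradicting `|z i| ≤ ρ`
  have hfpos : 0 < f := by
    rcases hf0.lt_or_eq with hlt | heq
    · exact hlt
    · exfalso
      have : coordDepth L u i = 0 := by
        unfold coordDepth; rw [← hf, ← heq]; simp [hL.le]
      rw [this] at hρ
      linarith [abs_nonneg (z i)]
  have hcd : coordDepth L u i = min (L * f) (L - L * f) := rfl
  rw [hcd] at hρ
  have hρ1 : ρ < L * f := hρ.trans_le (min_le_left _ _)
  have hρ2 : ρ < L - L * f := hρ.trans_le (min_le_right _ _)
  rw [abs_le] at hzi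
  -- both floors are `-1 - n`... more precisely `⌊z_i/L - f⌋ = ⌊-f⌋ = -1`
  simp only [cellIdx]
  have hz' : (z i - u i) / L = (z i / L - f) + ((-n : ℤ) : ℝ) := by
    rw [sub_div, huf]; push_cast; ring
  have h0' : ((0 : E3) i - u i) / L = (-f) + ((-n : ℤ) : ℝ) := by
    have : ((0 : E3) i : ℝ) = 0 := rfl
    rw [this, zero_sub, neg_div, huf]; push_cast; ring
  rw [hz', h0', Int.floor_add_intCast, Int.floor_add_intCast]
  congr 1
  have hA : ⌊z i / L - f⌋ = -1 := by
    rw [Int.floor_eq_iff]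
    push_cast
    constructor
    · -- `-1 ≤ z_i/L - f` iff `L (f - 1) ≤ z_i`
      have : L * (f - 1) ≤ z i := by nlinarith
      have : f - 1 ≤ z i / L := by rw [le_div_iff₀ hL]; linarith
      linarith
    · have : z i < L * f := by linarith
      have : z i / L < f := by rw [div_lt_iff₀ hL]; linarith
      linarith
  have hB : ⌊(-f : ℝ)⌋ = -1 := by
    rw [Int.floor_eq_iff]
    push_cast
    constructor <;> linarith
  rw [hA, hB]

/-- Registered stub marker (helper part 8/14 of `stub_equilibriumInLaw`, line `equilibrium-in-law-surgery`):
deep roots have a ball inside their cell, `closedBall_subset_cell`, closed form. -/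
theorem stub_equilibriumInLaw_part08 :
    ∀ (L : ℝ), 0 < L → ∀ (ρ : ℝ) (u : EuclideanSpace ℝ (Fin 3)), ρ < depth L u →
      Metric.closedBall (0 : EuclideanSpace ℝ (Fin 3)) ρ ⊆ cell L u :=
  fun _ hL _ _ h => closedBall_subset_cell hL h

end Summit.AtomisticToContinuum.Crystallization.Theorems.PalmUnimodularRigidityMinimiserShells.EquilibriumInLaw.Phase

end
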